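import Summits.BirchSwinnertonDyer.BirchSwinnertonDyer.Theorems.ErratumRoadFiveSelmerDefectGenerators
import Summits.BirchSwinnertonDyer.BirchSwinnertonDyer.Theorems.ErratumRoadFiveMuTransfer
import HarnessLib

/-!
# Route `ErratumRoadFive` (K2, `p ≥ 5`), crux (T) `Rest3TorsionBranchAtFive` (item
# stmt-BirchSwinnertonDyer-19702): THEOREM T♭ at the Selmer level WITH THE Σ-REMOVAL INSERTED BEFORE THE
# CANCELLATION — the kernel form valid ALSO when the Σ-imprimitive `L`-function has positive `μ`
# (a ramified `𝔮 ∈ Σ` with `p ∣ q + 1`), fed by the primitive `μ = 0` of step (7′) (memo §33)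

Cell `bsd-stepL` (run/shared/lean/pub/bsd-stepL/), seat `bsd-stepL-bdp` (prover g15, 2026-08-27), memo
`HOME/proof/PROOF-BDP.md` §31.3, §32.8–32.10, §33; `--supports stmt-BirchSwinnertonDyer-19702 --as helper`.

WHY. g14's Selmer-level kernel form of T♭ (p473369 `SelmerDefectAssembly.…boundedDefect`; p475110
`SelmerDefectGenerators.…_finite_localInvariants`) takes `hL : π ∤ L` for the SAME `L` as the congruence `hc`. The erratum prints (b), (c),
(2.5) and Lemma 2.1 only at a `Σ` containing the primes dividing `M` (p. 4), so those theorems must be run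
with `L = L^Σ_𝔭(f)` — and `μ(L^Σ_𝔭(f))` can be POSITIVE (a ramified `𝔮 ∈ Σ` contributes the constant
Euler factor `1 + q⁻¹`; [JSW17, §3.4, Remark]). Memo §31.3 therefore removes `Σ` (step (6)) BEFORE the
cancellation (8), and step (7′) (memo §33; kernel `MuTransfer`, p480030) supplies the PRIMITIVE
`μ(L_𝔭(f)) = 0`. THIS FILE records that order of operations at the Selmer level:

* `mul_fittingIdeal_le_of_selmer_congruences_boundedDefect` — the `μ`-FREE CORE of p473369's assembly:
  the same Selmer data (no `π` prime, no `π ∤ L`, no torsion hypothesis on `X`) give the defect-tolerant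
  limit `(π^{kn})·Fitt_Λ(Sel(M_f)^∨) ⊆ (L^Σ)` (memo §31.3 (1)–(4));
* `charIdeal_le_span_of_mul_fittingIdeal_le_imprimitive` — the tail (5), (6), (8): from that inclusion,
  `L^Σ = L·P`, `P ≠ 0`, `Ch(X₀)·(P) ⊆ Ch(X^Σ)` (the injective half of JSW17's Σ-bookkeeping, proof of
  Thm. 6.1.6), torsion + no finite submodules on both modules, and the PRIMITIVE `π ∤ L`: `Ch(X₀) ⊆ (L)`;
* `charIdeal_le_of_selmer_congruences_boundedDefect_imprimitive` and
  `…_finite_localInvariants_imprimitive` — the Σ-inserted twins of p473369 / p475110;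
* `charIdeal_le_of_selmer_congruences_finite_localInvariants_printed` — the same with `hL` REPLACED by the
  printed data of step (7′) (`MuTransfer.not_C_dvd_of_printed_congruence`: ONE inclusion of (c) at ONE level
  `m₀`, the common ramified constant `C = ϖ^t·u`, split Euler factors `Q_w(z_w)` with `Q_w(0)` a `ϖ`-unit
  and `z_w` non-constant mod `ϖ`, and Hsieh's `ϖ ∤ L_𝔭(g_{m₀})`).

HONEST FRAMING: theorems only (no definition, no named fact, no `sorry`); PURE ALGEBRA on abstract Selmer
data (multr1-p1's `ContinuousRep`/`selmer` currency); the arithmetic objects (`M_E`, `M_{g_m}`, `X^Σ` vs `X`,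
the Euler factors of [Cas18, (3.1)], (a)(b)(c), FW21 4.41, Lemma 2.2, [Hsi14, Thm. B]) are NOT constructed or
asserted (dictionary: memo §33.3). Nothing is booked; no census word, tier or label moves (T7).
References: [Castella2018Erratum] Lemma 2.1, proof of Thm. 1.1, footnote 1 (p. 4); [JetchevSkinnerWan2017]
§3.4 and proof of Thm. 6.1.6; [Castella2018] (3.1); [Hsieh2014] Thm. B; memo §31.3, §32.8–32.10, §33.
-/

set_option autoImplicit false
-- the Theorems namespace of this sub repeats the summit name by design (D-0017 nested layout)
set_option linter.dupNamespace false

noncomputable section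

open CategoryTheory CharacterModule Literature.NumberTheory.GaloisRepresentations
  Literature.RingTheory.FittingIdeal Literature.NumberTheory.EllipticCurves
  Literature.NumberTheory.EllipticCurves.Module
  Summit.BirchSwinnertonDyer.Rank1Residual.X11b.TorsionControl
  Summit.BirchSwinnertonDyer.Rank1Residual.X11b
  Summit.BirchSwinnertonDyer.Rank1Residual.X11b.CongruenceLimit
  Summit.BirchSwinnertonDyer.BirchSwinnertonDyer.Theorems.SelmerControlDefect
  Summit.BirchSwinnertonDyer.BirchSwinnertonDyer.Theorems.PontryaginDefect
  Summit.BirchSwinnertonDyer.BirchSwinnertonDyer.Theorems.SelmerDefectAssembly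
  Summit.BirchSwinnertonDyer.BirchSwinnertonDyer.Theorems.SelmerDefectGenerators
open scoped ContRepresentation

namespace Summit.BirchSwinnertonDyer.BirchSwinnertonDyer.Theorems.SelmerDefectAssemblySigma

open Summit.BirchSwinnertonDyer.BirchSwinnertonDyer.Theorems.BoundedCongruenceLimit
  Summit.BirchSwinnertonDyer.BirchSwinnertonDyer.Theorems.MuTransfer

/-! ### §1 The tail (5), (6), (8) from the defect-tolerant limit (any complete DVR `𝒪`) -/

section Tail

open Summit.BirchSwinnertonDyer.Rank1Residual.X11b.CongruenceLimit.PowerSeriesDVR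

variable {𝒪 : Type} [CommRing 𝒪] [IsDomain 𝒪] [IsDiscreteValuationRing 𝒪]
  [IsAdicComplete (IsLocalRing.maximalIdeal 𝒪) 𝒪]

/-- **Steps (5), (6), (8) of memo §31.3 from the defect-tolerant limit (4).** Over `Λ = 𝒪⟦T⟧`: if
`(π^c)·Fitt₀(X^Σ) ⊆ (L^Σ)` (the `μ`-free limit), `L^Σ = L·P` with `P ≠ 0` ([Cas18, (3.1)]),
`Ch(X₀)·(P) ⊆ Ch(X^Σ)` (injective half of the Selmer-side Σ-bookkeeping), `X^Σ` and `X₀` torsion with no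
non-zero finite submodule, and `π` prime with `π ∤ L` (the PRIMITIVE `μ = 0`), then `Ch(X₀) ⊆ (L)`. Pure
algebra. [cite: Castella2018Erratum, proof of Thm. 1.1 (p. 4), read one-sidedly and without (iv)]
[cite: JetchevSkinnerWan2017, proof of Thm. 6.1.6 (Σ-removal on the Selmer side)] -/
theorem charIdeal_le_span_of_mul_fittingIdeal_le_imprimitive
    {MS : Type} [AddCommGroup MS] [Module (PowerSeries 𝒪) MS] [Module.Finite (PowerSeries 𝒪) MS]
    {M₀ : Type} [AddCommGroup M₀] [Module (PowerSeries 𝒪) M₀] [Module.Finite (PowerSeries 𝒪) M₀]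
    {L LS P π : PowerSeries 𝒪} (hπ : Prime π) (hL : ¬ π ∣ L) (hLS : LS = L * P) (hP : P ≠ 0) (c : ℕ)
    (hFitt : Ideal.span {π ^ c} * Module.fittingIdeal (PowerSeries 𝒪) MS 0 ≤ Ideal.span {LS})
    (hTS : Module.IsTorsion (PowerSeries 𝒪) MS)
    (hnfS : ∀ N' : Submodule (PowerSeries 𝒪) MS, Module.length (PowerSeries 𝒪) N' ≠ ⊤ → N' = ⊥)
    (hT₀ : Module.IsTorsion (PowerSeries 𝒪) M₀)
    (hnf₀ : ∀ N' : Submodule (PowerSeries 𝒪) M₀, Module.length (PowerSeries 𝒪) N' ≠ ⊤ → N' = ⊥)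
    (hSig : charIdeal (PowerSeries 𝒪) M₀ * Ideal.span {P} ≤ charIdeal (PowerSeries 𝒪) MS) :
    charIdeal (PowerSeries 𝒪) M₀ ≤ Ideal.span {L} := by
  have hFCS : Module.fittingIdeal (PowerSeries 𝒪) MS 0 = charIdeal (PowerSeries 𝒪) MS :=
    fittingIdeal_zero_eq_charIdeal_of_forall_length MS hTS hnfS
  have hFC₀ : Module.fittingIdeal (PowerSeries 𝒪) M₀ 0 = charIdeal (PowerSeries 𝒪) M₀ :=
    fittingIdeal_zero_eq_charIdeal_of_forall_length M₀ hT₀ hnf₀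
  have hprinc : (Module.fittingIdeal (PowerSeries 𝒪) M₀ 0).IsPrincipal :=
    fittingIdeal_zero_isPrincipal_of_forall_length M₀ hT₀ hnf₀
  obtain ⟨f₀, hf₀⟩ := hprinc
  have hf₀' : charIdeal (PowerSeries 𝒪) M₀ = Ideal.span {f₀} := hFC₀ ▸ hf₀
  have h6 : Ideal.span {π ^ c} * (Ideal.span {f₀} * Ideal.span {P}) ≤ Ideal.span {L * P} := by
    rw [← hf₀', ← hLS]
    calc Ideal.span {π ^ c} * (charIdeal (PowerSeries 𝒪) M₀ * Ideal.span {P})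
        ≤ Ideal.span {π ^ c} * charIdeal (PowerSeries 𝒪) MS := Ideal.mul_mono_right hSig
      _ = Ideal.span {π ^ c} * Module.fittingIdeal (PowerSeries 𝒪) MS 0 := by rw [hFCS]
      _ ≤ Ideal.span {LS} := hFitt
  rw [Ideal.span_singleton_mul_span_singleton, Ideal.span_singleton_mul_span_singleton,
    Ideal.span_singleton_le_span_singleton] at h6
  have h7 : L ∣ π ^ c * f₀ := by
    obtain ⟨r, hr⟩ := h6
    refine ⟨r, mul_right_cancel₀ hP ?_⟩
    calc π ^ c * f₀ * P = π ^ c * (f₀ * P) := by ring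
      _ = L * P * r := hr
      _ = L * r * P := by ring
  rw [hf₀', Ideal.span_singleton_le_span_singleton]
  exact dvd_of_dvd_prime_pow_mul hπ hL c h7

end Tail

/-! ### §2 The `μ`-free core of the Selmer-level assembly, and the Σ-inserted end forms -/

section Assembly

variable {𝒪 : Type} [CommRing 𝒪] [IsDomain 𝒪] [IsDiscreteValuationRing 𝒪]
  [IsAdicComplete (IsLocalRing.maximalIdeal 𝒪) 𝒪] [TopologicalSpace (PowerSeries 𝒪)]
variable {Γ₀ : Type} [Group Γ₀] [TopologicalSpace Γ₀] [IsTopologicalGroup Γ₀]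
variable {ι₀ : Type*} {Γw : ι₀ → Type} [∀ v, Group (Γw v)] [∀ v, TopologicalSpace (Γw v)]
  [∀ v, IsTopologicalGroup (Γw v)] (ψ : ∀ v, Γw v →ₜ* Γ₀) (L₀ : Set ι₀)

omit [IsAdicComplete (IsLocalRing.maximalIdeal 𝒪) 𝒪] in
/-- **The `μ`-FREE CORE of THEOREM T♭ at the Selmer level** (memo §31.3 (1)–(4)): from `a`-divisible
congruent discrete Galois modules `M_f`, `M_{g_m}` with vanishing GLOBAL invariants, local invariants of the
`M_{g_m}` at the constrained places killed by `π^k` uniformly (NO local vanishing; `π` ANY element),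
`Ch(X_m) ⊆ (L_m)` when torsion, `(L_m) + (a)^m = (L^Σ) + (a)^m`, and the generator bound `hgen` on the dual
defects, conclude **`(π^{kn})·Fitt_Λ(Sel(M_f)^∨) ⊆ (L^Σ)`** — by Krull's intersection theorem, with NO
hypothesis on `L^Σ` (no `μ = 0`) and NO torsion hypothesis on `Sel(M_f)^∨`. The plumbing is p473369's,
verbatim, ending in `BoundedCongruenceLimit.mul_fittingIdeal_le_span_of_congruences` instead of the end form.
[cite: Castella2018Erratum, proof of Thm. 1.1 (p. 4), read one-sidedly and without (iv)] -/
theorem mul_fittingIdeal_le_of_selmer_congruences_boundedDefect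
    (a : PowerSeries 𝒪) (ha : Ideal.span {a} ≤ (⊥ : Ideal (PowerSeries 𝒪)).jacobson)
    {Mf : Type} [AddCommGroup Mf] [Module (PowerSeries 𝒪) Mf] [TopologicalSpace Mf]
    [DiscreteTopology Mf] [ContinuousSMul (PowerSeries 𝒪) Mf] (ρf : ContinuousRep Γ₀ (PowerSeries 𝒪) Mf)
    (hdivf : Function.Surjective fun x : Mf => a • x) (h0f : ρf.toTopRep.ρ.invariants = ⊥)
    (Mg : ℕ → Type) [∀ m, AddCommGroup (Mg m)] [∀ m, Module (PowerSeries 𝒪) (Mg m)]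
    [∀ m, TopologicalSpace (Mg m)] [∀ m, DiscreteTopology (Mg m)]
    [∀ m, ContinuousSMul (PowerSeries 𝒪) (Mg m)] (ρg : ∀ m, ContinuousRep Γ₀ (PowerSeries 𝒪) (Mg m))
    (hdivg : ∀ m, Function.Surjective fun x : Mg m => a • x)
    (h0g : ∀ m, (ρg m).toTopRep.ρ.invariants = ⊥)
    (θ : ∀ m, 1 ≤ m → ((torsionRep (ρg m) (a ^ m)).toTopRep ≅ (torsionRep ρf (a ^ m)).toTopRep))
    [Module.Finite (PowerSeries 𝒪) (CharacterModule (selmer ψ L₀ ρf))]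
    [∀ m, Module.Finite (PowerSeries 𝒪) (CharacterModule (selmer ψ L₀ (ρg m)))]
    {LS : PowerSeries 𝒪} (π : PowerSeries 𝒪) (k n : ℕ) (Lm : ℕ → PowerSeries 𝒪)
    (hkillg : ∀ m, ∀ v ∈ L₀, ∀ w : Mg m,
      w ∈ (((ρg m).restrict (ψ v)).toTopRep).ρ.invariants → π ^ k • w = 0)
    (hgen : ∀ m, 1 ≤ m → ∃ κ : Fin n → CharacterModule
      (↥(Submodule.torsionBy (PowerSeries 𝒪) ↥(selmer ψ L₀ (ρg m)) (a ^ m)) ⧸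
        Submodule.comap ((selmer ψ L₀ (ρg m)).subtype ∘ₗ
            (Submodule.torsionBy (PowerSeries 𝒪) ↥(selmer ψ L₀ (ρg m)) (a ^ m)).subtype)
          (Submodule.map (torsionInclH1 (ρg m) (a ^ m)) (selmer ψ L₀ (torsionRep (ρg m) (a ^ m))))),
      Submodule.span (PowerSeries 𝒪) (Set.range κ) = ⊤)
    (hCh : ∀ m, 1 ≤ m → Module.IsTorsion (PowerSeries 𝒪) (CharacterModule (selmer ψ L₀ (ρg m))) →
      charIdeal (PowerSeries 𝒪) (CharacterModule (selmer ψ L₀ (ρg m))) ≤ Ideal.span {Lm m})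
    (hc : ∀ m, 1 ≤ m →
      Ideal.span {Lm m} ⊔ (Ideal.span {a}) ^ m = Ideal.span {LS} ⊔ (Ideal.span {a}) ^ m) :
    Ideal.span {π ^ (k * n)} * Module.fittingIdeal (PowerSeries 𝒪) (CharacterModule (selmer ψ L₀ ρf)) 0 ≤
      Ideal.span {LS} := by
  -- f-side: `j^f_m : Sel(M_f[a^m]) ↪ Sel(M_f)`, `Q_m := Sel(M_f[a^m])^∨`, `α_m := (j^f_m)^∨` surjective
  let jf : ∀ m : ℕ, ↥(selmer ψ L₀ (torsionRep ρf (a ^ m))) →ₗ[PowerSeries 𝒪] ↥(selmer ψ L₀ ρf) :=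
    fun m => LinearMap.codRestrict (selmer ψ L₀ ρf)
      ((torsionInclH1 ρf (a ^ m)).domRestrict (selmer ψ L₀ (torsionRep ρf (a ^ m))))
      fun x => cohomologyMap_mem_selmer ψ L₀ (torsionIncl ρf (a ^ m)) x.2
  have hjf : ∀ m, Function.Injective (jf m) := by
    intro m x x' h
    have h1 := congrArg Subtype.val h
    exact Subtype.ext (cohomologyMap_torsionIncl_injective ρf (a ^ m) (surjective_pow_smul a hdivf m)
      (invariants_divisible_of_eq_bot ρf (a ^ m) h0f) h1)
  haveI : ∀ m, Module.Finite (PowerSeries 𝒪) (CharacterModule ↥(selmer ψ L₀ (torsionRep ρf (a ^ m)))) :=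
    fun m => Module.Finite.of_surjective (dual (jf m)) (dual_surjective_of_injective (jf m) (hjf m))
  -- g-side: `S_m := Sel(M_{g_m})[a^m]`, `j_m : Sel(M_{g_m}[a^m]) ↪ S_m`, its range `U_m`
  let Sg : ∀ m : ℕ, Submodule (PowerSeries 𝒪) ↥(selmer ψ L₀ (ρg m)) :=
    fun m => Submodule.torsionBy (PowerSeries 𝒪) ↥(selmer ψ L₀ (ρg m)) (a ^ m)
  let jg : ∀ m : ℕ, ↥(selmer ψ L₀ (torsionRep (ρg m) (a ^ m))) →ₗ[PowerSeries 𝒪] ↥(Sg m) :=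
    fun m => LinearMap.codRestrict (Sg m)
      (LinearMap.codRestrict (selmer ψ L₀ (ρg m))
        ((torsionInclH1 (ρg m) (a ^ m)).domRestrict (selmer ψ L₀ (torsionRep (ρg m) (a ^ m))))
        fun x => cohomologyMap_mem_selmer ψ L₀ (torsionIncl (ρg m) (a ^ m)) x.2)
      fun x => (Submodule.mem_torsionBy_iff (a ^ m) _).2
        (Subtype.ext (smul_cohomologyMap_torsionIncl (ρg m) (a ^ m) x.1))
  have hjg : ∀ m, Function.Injective (jg m) := by
    intro m x x' h
    have h1 : (((jg m x : ↥(Sg m)) : ↥(selmer ψ L₀ (ρg m))) : continuousCohomology 1 (ρg m).toTopRep) =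
        (((jg m x' : ↥(Sg m)) : ↥(selmer ψ L₀ (ρg m))) : continuousCohomology 1 (ρg m).toTopRep) := by
      rw [h]
    exact Subtype.ext (cohomologyMap_torsionIncl_injective (ρg m) (a ^ m) (surjective_pow_smul a (hdivg m) m)
      (invariants_divisible_of_eq_bot (ρg m) (a ^ m) (h0g m)) h1)
  let U : ∀ m : ℕ, Submodule (PowerSeries 𝒪) ↥(Sg m) := fun m =>
    Submodule.comap ((selmer ψ L₀ (ρg m)).subtype ∘ₗ (Sg m).subtype)
      (Submodule.map (torsionInclH1 (ρg m) (a ^ m)) (selmer ψ L₀ (torsionRep (ρg m) (a ^ m))))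
  have hU : ∀ m, LinearMap.range (jg m) = U m := by
    intro m
    ext s
    constructor
    · rintro ⟨x, rfl⟩
      exact ⟨x, x.2, rfl⟩
    · rintro ⟨x, hx, hxs⟩
      refine ⟨⟨x, hx⟩, Subtype.ext (Subtype.ext ?_)⟩
      exact hxs
  -- the dual defect `Kd_m := (S_m ⧸ U_m)^∨` is killed by `π^k` (Lemma 2.1♭ + (L1)-shaped input)
  have hkill : ∀ m, 1 ≤ m → π ^ k ∈ Module.annihilator (PowerSeries 𝒪)
      (CharacterModule (↥(Sg m) ⧸ U m)) := by
    intro m _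
    refine mem_annihilator_characterModule_of_forall_smul_eq_zero (π ^ k) fun q => ?_
    obtain ⟨s, rfl⟩ := Submodule.mkQ_surjective (U m) q
    rw [← map_smul, Submodule.mkQ_apply, Submodule.Quotient.mk_eq_zero]
    have hs : (a ^ m) • ((s : ↥(selmer ψ L₀ (ρg m))) : continuousCohomology 1 (ρg m).toTopRep) = 0 := by
      have := (Submodule.mem_torsionBy_iff (a ^ m) (s : ↥(selmer ψ L₀ (ρg m)))).1 s.2
      exact congrArg Subtype.val this
    exact smul_mem_map_selmer_pow ψ L₀ (ρg m) a (hdivg m) (π ^ k) (hkillg m) m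
      (s : ↥(selmer ψ L₀ (ρg m))).2 hs
  -- the isomorphisms `X_m/(a)^m ≃ S_m^∨` and `(Sel(M_{g_m}[a^m]))^∨ ≃ Q_m`
  let eS : ∀ m : ℕ, ((CharacterModule ↥(selmer ψ L₀ (ρg m)) ⧸
      (Ideal.span {a}) ^ m • (⊤ : Submodule (PowerSeries 𝒪) (CharacterModule ↥(selmer ψ L₀ (ρg m))))) ≃ₗ[PowerSeries 𝒪]
        CharacterModule ↥(Sg m)) :=
    fun m => Classical.choice (PontryaginCongruence.nonempty_quotIdealPow_equiv_dual_torsionBy a m)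
  let eP : ∀ m : ℕ, 1 ≤ m → (CharacterModule ↥(selmer ψ L₀ (torsionRep (ρg m) (a ^ m))) ≃ₗ[PowerSeries 𝒪]
      CharacterModule ↥(selmer ψ L₀ (torsionRep ρf (a ^ m)))) :=
    fun m hm => CharacterModule.congr (selmerCongr ψ L₀ (θ m hm))
  -- assemble into the `μ`-free defect-tolerant limit (Krull), with the bounded-kernel defect binder
  refine mul_fittingIdeal_le_span_of_congruences (Ideal.span {a}) (Ideal.span {π ^ (k * n)})
    (fun m => CharacterModule ↥(selmer ψ L₀ (ρg m)))
    (fun m => CharacterModule ↥(selmer ψ L₀ (torsionRep ρf (a ^ m))))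
    Lm ha (fun m _ => dual (jf m)) (fun m _ => dual_surjective_of_injective (jf m) (hjf m))
    (fun m hm => ?_) (fun m hm => fittingIdeal_zero_le_of_charIdeal_le (hCh m hm)) hc
  rw [pow_mul]
  exact defect_le_sup_of_boundedKernel (Ideal.span {a}) m
    (((eS m).symm : _ →ₗ[PowerSeries 𝒪] _) ∘ₗ dual (U m).mkQ)
    (((eP m hm) : _ →ₗ[PowerSeries 𝒪] _) ∘ₗ dual (jg m) ∘ₗ ((eS m) : _ →ₗ[PowerSeries 𝒪] _))
    (exact_dual_conj_of_eq (jg m) (U m) (hU m) (eS m) (eP m hm))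
    (dual_conj_surjective (jg m) (hjg m) (eS m) (eP m hm)) (hgen m hm) (hkill m hm)

/-- **THEOREM T♭ at the Selmer level, Σ-inserted** (memo §31.3 in the printed order (1)–(6), (8), with
(7′) as the input `hL`): the Selmer data of p473369 at level `Σ` (congruence with `L^Σ`), plus the
Σ-removal data `L^Σ = L·P`, `P ≠ 0`, `Ch(X₀)·(P) ⊆ Ch(Sel(M_f)^∨)`, `X₀` and `Sel(M_f)^∨` torsion without
non-zero finite submodules, and the PRIMITIVE `μ = 0` `π ∤ L` (`π` prime) give **`Ch_Λ(X₀) ⊆ (L)`** —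
`X₀ = X_ac(E[p^∞])` (Σ = ∅), `L = L_𝔭(f)`. Valid whether or not `π ∣ L^Σ`.
[cite: Castella2018Erratum, proof of Thm. 1.1 (p. 4), read one-sidedly and without (iv)]
[cite: JetchevSkinnerWan2017, proof of Thm. 6.1.6 (Σ-removal on the Selmer side)] -/
theorem charIdeal_le_of_selmer_congruences_boundedDefect_imprimitive
    (a : PowerSeries 𝒪) (ha : Ideal.span {a} ≤ (⊥ : Ideal (PowerSeries 𝒪)).jacobson)
    {Mf : Type} [AddCommGroup Mf] [Module (PowerSeries 𝒪) Mf] [TopologicalSpace Mf]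
    [DiscreteTopology Mf] [ContinuousSMul (PowerSeries 𝒪) Mf] (ρf : ContinuousRep Γ₀ (PowerSeries 𝒪) Mf)
    (hdivf : Function.Surjective fun x : Mf => a • x) (h0f : ρf.toTopRep.ρ.invariants = ⊥)
    (Mg : ℕ → Type) [∀ m, AddCommGroup (Mg m)] [∀ m, Module (PowerSeries 𝒪) (Mg m)]
    [∀ m, TopologicalSpace (Mg m)] [∀ m, DiscreteTopology (Mg m)]
    [∀ m, ContinuousSMul (PowerSeries 𝒪) (Mg m)] (ρg : ∀ m, ContinuousRep Γ₀ (PowerSeries 𝒪) (Mg m))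
    (hdivg : ∀ m, Function.Surjective fun x : Mg m => a • x)
    (h0g : ∀ m, (ρg m).toTopRep.ρ.invariants = ⊥)
    (θ : ∀ m, 1 ≤ m → ((torsionRep (ρg m) (a ^ m)).toTopRep ≅ (torsionRep ρf (a ^ m)).toTopRep))
    [Module.Finite (PowerSeries 𝒪) (CharacterModule (selmer ψ L₀ ρf))]
    [∀ m, Module.Finite (PowerSeries 𝒪) (CharacterModule (selmer ψ L₀ (ρg m)))]
    {M₀ : Type} [AddCommGroup M₀] [Module (PowerSeries 𝒪) M₀] [Module.Finite (PowerSeries 𝒪) M₀]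
    {π L LS P : PowerSeries 𝒪} (hπ : Prime π) (hL : ¬ π ∣ L) (hLS : LS = L * P) (hP : P ≠ 0)
    (k n : ℕ) (Lm : ℕ → PowerSeries 𝒪)
    (hkillg : ∀ m, ∀ v ∈ L₀, ∀ w : Mg m,
      w ∈ (((ρg m).restrict (ψ v)).toTopRep).ρ.invariants → π ^ k • w = 0)
    (hgen : ∀ m, 1 ≤ m → ∃ κ : Fin n → CharacterModule
      (↥(Submodule.torsionBy (PowerSeries 𝒪) ↥(selmer ψ L₀ (ρg m)) (a ^ m)) ⧸
        Submodule.comap ((selmer ψ L₀ (ρg m)).subtype ∘ₗ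
            (Submodule.torsionBy (PowerSeries 𝒪) ↥(selmer ψ L₀ (ρg m)) (a ^ m)).subtype)
          (Submodule.map (torsionInclH1 (ρg m) (a ^ m)) (selmer ψ L₀ (torsionRep (ρg m) (a ^ m))))),
      Submodule.span (PowerSeries 𝒪) (Set.range κ) = ⊤)
    (hCh : ∀ m, 1 ≤ m → Module.IsTorsion (PowerSeries 𝒪) (CharacterModule (selmer ψ L₀ (ρg m))) →
      charIdeal (PowerSeries 𝒪) (CharacterModule (selmer ψ L₀ (ρg m))) ≤ Ideal.span {Lm m})
    (hc : ∀ m, 1 ≤ m →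
      Ideal.span {Lm m} ⊔ (Ideal.span {a}) ^ m = Ideal.span {LS} ⊔ (Ideal.span {a}) ^ m)
    (hTS : Module.IsTorsion (PowerSeries 𝒪) (CharacterModule (selmer ψ L₀ ρf)))
    (hnfS : ∀ N' : Submodule (PowerSeries 𝒪) (CharacterModule (selmer ψ L₀ ρf)),
      Module.length (PowerSeries 𝒪) N' ≠ ⊤ → N' = ⊥)
    (hT₀ : Module.IsTorsion (PowerSeries 𝒪) M₀)
    (hnf₀ : ∀ N' : Submodule (PowerSeries 𝒪) M₀, Module.length (PowerSeries 𝒪) N' ≠ ⊤ → N' = ⊥)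
    (hSig : charIdeal (PowerSeries 𝒪) M₀ * Ideal.span {P} ≤
      charIdeal (PowerSeries 𝒪) (CharacterModule (selmer ψ L₀ ρf))) :
    charIdeal (PowerSeries 𝒪) M₀ ≤ Ideal.span {L} :=
  charIdeal_le_span_of_mul_fittingIdeal_le_imprimitive hπ hL hLS hP (k * n)
    (mul_fittingIdeal_le_of_selmer_congruences_boundedDefect ψ L₀ a ha ρf hdivf h0f Mg ρg hdivg h0g θ π k n
      Lm hkillg hgen hCh hc)
    hTS hnfS hT₀ hnf₀ hSig

/-- **THEOREM T♭ at the Selmer level, Σ-inserted, (G2) discharged** — the twin of p475110's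
`SelmerDefectGenerators.powerSeries_charIdeal_le_of_selmer_congruences_finite_localInvariants`: a single
constrained place `v₀` (the erratum's `Sel_𝔭`), the local invariants `M_{g_m}^{Γ_{v₀}}` FINITE with
`Nat.card ≤ B` and killed by `π^k`, uniformly in `m` (= (L1) + (g), memo §31.2); the congruence at level
`Σ`; Σ-removal data; primitive `π ∤ L`. Conclusion **`Ch_Λ(X₀) ⊆ (L)`**.
[cite: Castella2018Erratum, proof of Thm. 1.1 (p. 4), read one-sidedly and without (iv)] -/
theorem charIdeal_le_of_selmer_congruences_finite_localInvariants_imprimitive (v₀ : ι₀)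
    (a : PowerSeries 𝒪) (ha : Ideal.span {a} ≤ (⊥ : Ideal (PowerSeries 𝒪)).jacobson)
    {Mf : Type} [AddCommGroup Mf] [Module (PowerSeries 𝒪) Mf] [TopologicalSpace Mf]
    [DiscreteTopology Mf] [ContinuousSMul (PowerSeries 𝒪) Mf] (ρf : ContinuousRep Γ₀ (PowerSeries 𝒪) Mf)
    (hdivf : Function.Surjective fun x : Mf => a • x) (h0f : ρf.toTopRep.ρ.invariants = ⊥)
    (Mg : ℕ → Type) [∀ m, AddCommGroup (Mg m)] [∀ m, Module (PowerSeries 𝒪) (Mg m)]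
    [∀ m, TopologicalSpace (Mg m)] [∀ m, DiscreteTopology (Mg m)]
    [∀ m, ContinuousSMul (PowerSeries 𝒪) (Mg m)] (ρg : ∀ m, ContinuousRep Γ₀ (PowerSeries 𝒪) (Mg m))
    (hdivg : ∀ m, Function.Surjective fun x : Mg m => a • x)
    (h0g : ∀ m, (ρg m).toTopRep.ρ.invariants = ⊥)
    (θ : ∀ m, 1 ≤ m → ((torsionRep (ρg m) (a ^ m)).toTopRep ≅ (torsionRep ρf (a ^ m)).toTopRep))
    [Module.Finite (PowerSeries 𝒪) (CharacterModule (selmer ψ {v₀} ρf))]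
    [∀ m, Module.Finite (PowerSeries 𝒪) (CharacterModule (selmer ψ {v₀} (ρg m)))]
    [∀ m, Finite (((ρg m).restrict (ψ v₀)).toTopRep).ρ.invariants]
    {M₀ : Type} [AddCommGroup M₀] [Module (PowerSeries 𝒪) M₀] [Module.Finite (PowerSeries 𝒪) M₀]
    {π L LS P : PowerSeries 𝒪} (hπ : Prime π) (hL : ¬ π ∣ L) (hLS : LS = L * P) (hP : P ≠ 0)
    (k B : ℕ) (Lm : ℕ → PowerSeries 𝒪)
    (hkillg : ∀ m, ∀ w : Mg m, w ∈ (((ρg m).restrict (ψ v₀)).toTopRep).ρ.invariants → π ^ k • w = 0)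
    (hB : ∀ m, Nat.card (((ρg m).restrict (ψ v₀)).toTopRep).ρ.invariants ≤ B)
    (hCh : ∀ m, 1 ≤ m → Module.IsTorsion (PowerSeries 𝒪) (CharacterModule (selmer ψ {v₀} (ρg m))) →
      charIdeal (PowerSeries 𝒪) (CharacterModule (selmer ψ {v₀} (ρg m))) ≤ Ideal.span {Lm m})
    (hc : ∀ m, 1 ≤ m →
      Ideal.span {Lm m} ⊔ (Ideal.span {a}) ^ m = Ideal.span {LS} ⊔ (Ideal.span {a}) ^ m)
    (hTS : Module.IsTorsion (PowerSeries 𝒪) (CharacterModule (selmer ψ {v₀} ρf)))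
    (hnfS : ∀ N' : Submodule (PowerSeries 𝒪) (CharacterModule (selmer ψ {v₀} ρf)),
      Module.length (PowerSeries 𝒪) N' ≠ ⊤ → N' = ⊥)
    (hT₀ : Module.IsTorsion (PowerSeries 𝒪) M₀)
    (hnf₀ : ∀ N' : Submodule (PowerSeries 𝒪) M₀, Module.length (PowerSeries 𝒪) N' ≠ ⊤ → N' = ⊥)
    (hSig : charIdeal (PowerSeries 𝒪) M₀ * Ideal.span {P} ≤
      charIdeal (PowerSeries 𝒪) (CharacterModule (selmer ψ {v₀} ρf))) :
    charIdeal (PowerSeries 𝒪) M₀ ≤ Ideal.span {L} :=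
  charIdeal_le_of_selmer_congruences_boundedDefect_imprimitive ψ {v₀} a ha ρf hdivf h0f Mg ρg hdivg h0g θ
    hπ hL hLS hP k B Lm (fun m v hv w hw => by
      rw [Set.mem_singleton_iff] at hv
      subst hv
      exact hkillg m w hw)
    (fun m _ => exists_fin_span_dual_defect ψ v₀ (ρg m) (a ^ m) (surjective_pow_smul a (hdivg m) m)
      (h0g m) (hB m))
    hCh hc hTS hnfS hT₀ hnf₀ hSig

/-- **THEOREM T♭ at the Selmer level with the `μ = 0` input in PRINTED SHAPE (step (7′), memo §33).** As
`charIdeal_le_of_selmer_congruences_finite_localInvariants_imprimitive` with `π = C ϖ` (`ϖ` a prime of `𝒪`,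
so `π` is prime in `𝒪⟦T⟧`) and the hypothesis `π ∤ L` REPLACED by the data of
`MuTransfer.not_C_dvd_of_printed_congruence` at ONE level `m₀`: the printed (c) as an ideal equality modulo
`J ⊆ (ϖ^{t+1})` between `L(g_{m₀})·C(g_{m₀})·∏_{w∈S} Q^{(m₀)}_w(z_w)` and `L·C·∏_{w∈S} Q_w(z'_w)`
([Cas18, (3.1)]), the common ramified constant `C(g_{m₀}) = ϖ^t·u` with `ϖ ∤ u` and `ϖ^t ∣ C` (footnote 1 of
the erratum), split Euler factors with `ϖ ∤ Q^{(m₀)}_w(0)` and `z_w` non-constant modulo `ϖ` (`γ_w ≠ 1`), and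
`ϖ ∤ L(g_{m₀})` ([Hsi14, Thm. B]). Conclusion **`Ch_Λ(X₀) ⊆ (L)`**, i.e. the route's one-sided divisibility
for `X_ac(E[p^∞])` on branch (T) ∩ witness, with NO `E(ℚ_p)[p] = 0` and NO `μ(L^Σ) = 0`. Pure algebra on
abstract data; CONDITIONAL on nothing; books nothing.
[cite: Castella2018Erratum, proof of Thm. 1.1, (c) and footnote 1 (p. 4), read one-sidedly and without (iv)]
[cite: Castella2018, (3.1)] [cite: Hsieh2014, Thm. B] -/
theorem charIdeal_le_of_selmer_congruences_finite_localInvariants_printed (v₀ : ι₀)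
    (a : PowerSeries 𝒪) (ha : Ideal.span {a} ≤ (⊥ : Ideal (PowerSeries 𝒪)).jacobson)
    {Mf : Type} [AddCommGroup Mf] [Module (PowerSeries 𝒪) Mf] [TopologicalSpace Mf]
    [DiscreteTopology Mf] [ContinuousSMul (PowerSeries 𝒪) Mf] (ρf : ContinuousRep Γ₀ (PowerSeries 𝒪) Mf)
    (hdivf : Function.Surjective fun x : Mf => a • x) (h0f : ρf.toTopRep.ρ.invariants = ⊥)
    (Mg : ℕ → Type) [∀ m, AddCommGroup (Mg m)] [∀ m, Module (PowerSeries 𝒪) (Mg m)]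
    [∀ m, TopologicalSpace (Mg m)] [∀ m, DiscreteTopology (Mg m)]
    [∀ m, ContinuousSMul (PowerSeries 𝒪) (Mg m)] (ρg : ∀ m, ContinuousRep Γ₀ (PowerSeries 𝒪) (Mg m))
    (hdivg : ∀ m, Function.Surjective fun x : Mg m => a • x)
    (h0g : ∀ m, (ρg m).toTopRep.ρ.invariants = ⊥)
    (θ : ∀ m, 1 ≤ m → ((torsionRep (ρg m) (a ^ m)).toTopRep ≅ (torsionRep ρf (a ^ m)).toTopRep))
    [Module.Finite (PowerSeries 𝒪) (CharacterModule (selmer ψ {v₀} ρf))]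
    [∀ m, Module.Finite (PowerSeries 𝒪) (CharacterModule (selmer ψ {v₀} (ρg m)))]
    [∀ m, Finite (((ρg m).restrict (ψ v₀)).toTopRep).ρ.invariants]
    {M₀ : Type} [AddCommGroup M₀] [Module (PowerSeries 𝒪) M₀] [Module.Finite (PowerSeries 𝒪) M₀]
    {ϖ : 𝒪} (hϖ : Prime ϖ) {L LS P : PowerSeries 𝒪} (hLS : LS = L * P) (hP : P ≠ 0)
    (k B : ℕ) (Lm : ℕ → PowerSeries 𝒪)
    (hkillg : ∀ m, ∀ w : Mg m, w ∈ (((ρg m).restrict (ψ v₀)).toTopRep).ρ.invariants →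
      PowerSeries.C ϖ ^ k • w = 0)
    (hB : ∀ m, Nat.card (((ρg m).restrict (ψ v₀)).toTopRep).ρ.invariants ≤ B)
    (hCh : ∀ m, 1 ≤ m → Module.IsTorsion (PowerSeries 𝒪) (CharacterModule (selmer ψ {v₀} (ρg m))) →
      charIdeal (PowerSeries 𝒪) (CharacterModule (selmer ψ {v₀} (ρg m))) ≤ Ideal.span {Lm m})
    (hc : ∀ m, 1 ≤ m →
      Ideal.span {Lm m} ⊔ (Ideal.span {a}) ^ m = Ideal.span {LS} ⊔ (Ideal.span {a}) ^ m)
    (hTS : Module.IsTorsion (PowerSeries 𝒪) (CharacterModule (selmer ψ {v₀} ρf)))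
    (hnfS : ∀ N' : Submodule (PowerSeries 𝒪) (CharacterModule (selmer ψ {v₀} ρf)),
      Module.length (PowerSeries 𝒪) N' ≠ ⊤ → N' = ⊥)
    (hT₀ : Module.IsTorsion (PowerSeries 𝒪) M₀)
    (hnf₀ : ∀ N' : Submodule (PowerSeries 𝒪) M₀, Module.length (PowerSeries 𝒪) N' ≠ ⊤ → N' = ⊥)
    (hSig : charIdeal (PowerSeries 𝒪) M₀ * Ideal.span {P} ≤
      charIdeal (PowerSeries 𝒪) (CharacterModule (selmer ψ {v₀} ρf)))
    -- the printed data of step (7′) at one level `m₀`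
    {Lm₀ C Cm u : PowerSeries 𝒪} {t : ℕ} {J : Ideal (PowerSeries 𝒪)}
    {ι : Type*} (S : Finset ι) (Q Qm : ι → Polynomial 𝒪) (z zm : ι → PowerSeries 𝒪)
    (hc₀ : Ideal.span {Lm₀ * Cm * ∏ i ∈ S, Polynomial.aeval (zm i) (Qm i)} ⊔ J =
      Ideal.span {L * C * ∏ i ∈ S, Polynomial.aeval (z i) (Q i)} ⊔ J)
    (hJ : J ≤ Ideal.span {PowerSeries.C ϖ ^ (t + 1)})
    (hCm : Cm = PowerSeries.C ϖ ^ t * u) (hu : ¬ PowerSeries.C ϖ ∣ u) (hC : PowerSeries.C ϖ ^ t ∣ C)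
    (hQ : ∀ i ∈ S, ¬ ϖ ∣ (Qm i).coeff 0)
    (hz : ∀ i ∈ S, PowerSeries.map (Ideal.Quotient.mk (Ideal.span {ϖ})) (zm i) ≠
      PowerSeries.C (PowerSeries.constantCoeff
        (PowerSeries.map (Ideal.Quotient.mk (Ideal.span {ϖ})) (zm i))))
    (hLm₀ : ¬ PowerSeries.C ϖ ∣ Lm₀) :
    charIdeal (PowerSeries 𝒪) M₀ ≤ Ideal.span {L} :=
  charIdeal_le_of_selmer_congruences_finite_localInvariants_imprimitive ψ v₀ a ha ρf hdivf h0f Mg ρg hdivg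
    h0g θ (prime_C_of_prime hϖ)
    (not_C_dvd_of_printed_congruence hϖ S Q Qm z zm hc₀ hJ hCm hu hC hQ hz hLm₀)
    hLS hP k B Lm hkillg hB hCh hc hTS hnfS hT₀ hnf₀ hSig

end Assembly

end Summit.BirchSwinnertonDyer.BirchSwinnertonDyer.Theorems.SelmerDefectAssemblySigma

end
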